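/-
Copyright (c) 2026 the pub-hodgecm-mathlib formalisation cell (harness21).  Prover seat hodgecm-mathlib-K2E5-p16 (g4): Track B «K2-LIT»,
hLiu418 = stmt-HodgeConjecture-24832, director req649 (S2) ∕ LEAD F0P6-plan (g11) deal of record 2026-09-04T05:23:13Z + LEAD box «=»
05:31:34Z = organ Φ6a of ROAD Φ (ruling «M-155l» §2; CENSUS-41 row Φ6): the Siegel–Gindikin gamma integral of the cone `Herm₂(ℂ)⁺`; 2026-09-04.
-/
import Summits.HodgeConjecture.HodgeConjecture.Theorems.K2LiuHermTwoGammaDefs            -- ★ p857639 (this seat): `hermTwoGamma`, `hermTwo` + API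
import Summits.HodgeConjecture.HodgeConjecture.Theorems.K2LiuHermTwoSiegelGindikinFibres   -- ★ (this seat): fibres `b`, `z`, `(z,b)` + integrability
import HarnessLib

/-!
# Crux `HLiu418`, ROAD Φ, organ Φ6a: the SIEGEL–GINDIKIN INTEGRAL on `Herm₂(ℂ)⁺`
# `∫_{x > 0} e^{−tr(x y)} (det x)^{s−2} dx = Γ₂(s) · (det y)^{−s}`  (`y > 0`, `1 < re s`), absolute convergence, holomorphy

Cell `hodgecm-mathlib`, crux item hLiu418 = `stmt-HodgeConjecture-24832`, route of record `HCCMUnconditional`; squad K2, LEAD F0P6-plan (g11)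
(deal req649 (S2), memo `F0/P6/F0P6-plan-g11/DEALS-req649-S1S2S3.v1.F0P6-plan-g11.md` §(S2); LEAD box «=» GO AS REPORTED 05:31:34Z), dealer
K2E5-plan (g5) (CENSUS-41 `K2/K2E5-plan/g5/CENSUS-41-SiegelEisensteinContinuation.K2E5-plan-g5.md` row Φ6, §3), prover K2E5-p16 (g4).
THEOREMS ONLY (no `def`, no instance, no notation, no named-fact hypothesis, no `sorry`, default heartbeats); Mathlib + ★ DEFS leaf only;
lane `--supports stmt-HodgeConjecture-24832 --as helper` (count-neutral helper).

WHAT IS PROVED (heads (b₁) (b₂) (b₃) (c) of the REPORT-FIRST, statement bytes as boxed by the LEAD).  With `dx` = Lebesgue measure of the chart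
`x = hermTwo (a, z, b) = [[a, z],[z̄, b]]`, `(a, z, b) ∈ ℝ × ℂ × ℝ` (`volume`; `dz` = Lebesgue measure of `ℂ ≅ ℝ²`), `Γ₂ = hermTwoGamma`:
* `integrableOn_siegelGindikin` — for `y` positive definite and `1 < re s`, `x ↦ e^{−tr(x y)} (det x)^{s−2}` is INTEGRABLE on the cone
  `{x > 0} = {c | (hermTwo c).PosDef}` (absolute convergence);
* `integral_siegelGindikin` — `∫_{x > 0} e^{−tr(x y)} (det x)^{s−2} dx = Γ₂(s) · (det y)^{−s}` (principal powers of the positive reals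
  `det x`, `det y`); chart form `integral_siegelGindikin_hermTwo` with the right-hand side `((p·q − |w|² : ℝ) : ℂ) ^ (−s)` spelled as the
  power of a real (`det_eq_ofReal_of_posDef` is the rewrite between the two);
* `integral_siegelGindikin_one` — `∫_{x > 0} e^{−tr x} (det x)^{s−2} dx = Γ₂(s) = π Γ(s) Γ(s−1)` (THE GAMMA FUNCTION OF THE CONE);
* `differentiableOn_integral_siegelGindikin` — the integral is holomorphic in `s` on the open half-plane `1 < re s`.

PROOF (elementary, print-free; no matrix square root, no `4`-dimensional change of variables).  Write `y = [[p, w],[w̄, q]]` (`0 < p`,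
`|w|² < pq`, hence `0 < q`); then `tr(x y) = ap + bq + 2 Re(z w̄)` and `det x = ab − |z|²` (★ DEFS leaf).  FUBINI in the order `b` (inner), `z`, `a`:
(1) for `a > 0`, `z` fixed the `b`-fibre lives on `b > |z|²/a`; the shift `b = |z|²/a + t` turns it into the Gamma integral
`∫₀^∞ (a t)^{s−2} e^{−q t} dt` (★ Mathlib `Complex.integral_cpow_mul_exp_neg_mul_Ioi`), value `e^{−(ap + q|z|²/a + 2Re(z w̄))} a^{s−2} q^{1−s} Γ(s−1)`;
(2) the `z`-fibre is the Gaussian `∫_ℂ e^{−(q/a)|z|² − 2⟨w, z⟩} dz = (π a/q) e^{a|w|²/q}` (★ Mathlib `GaussianFourier.integral_cexp_neg_mul_sq_norm_add`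
on the real inner-product space `ℂ`, `finrank ℝ ℂ = 2`, `⟨w, z⟩_ℝ = Re(z w̄)` = ★ `Complex.inner`), value `π Γ(s−1) q^{−s} a^{s−1} e^{−(p − |w|²/q) a}`;
(3) the `a`-fibre is the Gamma integral `∫₀^∞ a^{s−1} e^{−(p − |w|²/q) a} da = Γ(s) (p − |w|²/q)^{−s}`, and `q^{−s}(p − |w|²/q)^{−s} = (pq − |w|²)^{−s}`.
ABSOLUTE CONVERGENCE bottom-up by ★ `integrable_prod_iff`: the norm of the integrand at `s` IS the integrand at the real exponent `σ = re s`
(`norm_indicator_eq`), so every «`∫ ‖·‖` of a fibre» is the real part of the closed form one level down at `σ`, and every fibre is integrable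
because its Bochner integral is a NONZERO closed form (★ `Integrable.of_integral_ne_zero`).  HOLOMORPHY: on the open half-plane the integral
agrees with the holomorphic closed form `Γ₂(s)(det y)^{−s}` (★ `DifferentiableOn.congr`, ★ `differentiableOn_hermTwoGamma`, ★ `DifferentiableAt.const_cpow`).

CONSUMER.  Organ Φ6b of ROAD Φ (Shimura's confluent hypergeometric functions `ξ, ω` of the `Herm₂`-tube and their estimates, [Shimura1982 §§1, 3–4]):
the archimedean Whittaker coefficients of the Siegel Eisenstein series on `U(2,2)` (socket #41 `sig_K2LiuSiegelEisensteinContinuation`).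
NOT here: complex (tube) argument `y + iη` (needs contour rotation of the Gamma integral), general rank `Herm_n`, Bessel functions.
HONEST LABEL.  Count-neutral helper of the K2_Liu road; it pays no socket by itself: `HC_CM` is proved only modulo the 7 printed citations
(2 remaining named inputs: hLiu418 = `stmt-HodgeConjecture-24832`, h413 = `stmt-HodgeConjecture-24833`) until rung 0 closes.

## References (orientation only; everything below is proved from Mathlib)
* [Shimura1982] G. Shimura, *Confluent hypergeometric functions on tube domains*, Math. Ann. 260 (1982) 269–302: §1, (1.16) Case II (`m = 2`).
* J. Faraut, A. Korányi, *Analysis on Symmetric Cones* (Oxford 1994): Thm. VII.1.1 (the gamma integral of a symmetric cone).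
* C. L. Siegel, *Über die analytische Theorie der quadratischen Formen*, Ann. of Math. 36 (1935): Hilfssatz 37 (symmetric case).
-/

set_option autoImplicit false
-- the mandated namespace repeats the single-problem summit's segment (`HodgeConjecture.HodgeConjecture`)
set_option linter.dupNamespace false

noncomputable section

open Complex MeasureTheory Set
open scoped ComplexOrder ComplexConjugate

namespace Summit.HodgeConjecture.HodgeConjecture.Cruxes.HLiu418.K2LiuHermTwoGammaSiegelGindikin

open Summit.HodgeConjecture.HodgeConjecture.Cruxes.HLiu418.K2LiuHermTwoGammaDefs
open Summit.HodgeConjecture.HodgeConjecture.Cruxes.HLiu418.K2LiuHermTwoSiegelGindikinFibres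

/-! ## The computation in coordinates, level 3 (assembly over `a`)

As in the fibres file, `y = [[p, w],[w̄, q]]`, `f s` = the integrand in the chart and `D` = the cone are section variables with defining
equations `hf`, `hD` (no auxiliary `def`). -/

section Coordinates

variable {p q : ℝ} {w : ℂ}
variable (f : ℂ → ℝ × ℂ × ℝ → ℂ)
  (hf : ∀ (s : ℂ) (c : ℝ × ℂ × ℝ), f s c =
    cexp (-((c.1 * p + c.2.2 * q + 2 * (c.2.1 * conj w).re : ℝ) : ℂ)) *
      ((c.1 * c.2.2 - normSq c.2.1 : ℝ) : ℂ) ^ (s - 2))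
variable (D : Set (ℝ × ℂ × ℝ)) (hD : D = {c | 0 < c.1 ∧ normSq c.2.1 < c.1 * c.2.2})

/-! ### Fubini, level 3: integrability and value on `ℝ × ℂ × ℝ` -/

include hf hD in
/-- ABSOLUTE CONVERGENCE: the truncated integrand `1_{x>0} e^{−tr(xy)} (det x)^{s−2}` is integrable on the chart `ℝ × ℂ × ℝ`
for `y = [[p, w],[w̄, q]] > 0` and `1 < re s`. -/
theorem integrable_indicator_f (hq : 0 < q) (hpq : normSq w < p * q) {s : ℂ} (hs : 1 < s.re) :
    Integrable (D.indicator (f s)) ((volume : Measure ℝ).prod (volume : Measure (ℂ × ℝ))) := by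
  have hσ : 1 < ((s.re : ℂ)).re := by simpa using hs
  rw [integrable_prod_iff (measurable_indicator f hf D hD s).aestronglyMeasurable]
  refine ⟨Filter.Eventually.of_forall fun a => ?_, ?_⟩
  · by_cases ha : 0 < a
    · exact integrable_fibre_zb f hf D hD hq hs ha
    · have h0 : (fun zb : ℂ × ℝ => D.indicator (f s) (a, zb)) = fun _ => 0 := by
        funext zb
        rw [indicator_of_notMem]
        rw [hD]
        exact fun h => ha h.1
      rw [h0]
      exact integrable_zero _ _ _
  · have hre : (fun a : ℝ => ∫ zb : ℂ × ℝ, ‖D.indicator (f s) (a, zb)‖) =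
        fun a => ((Ioi (0 : ℝ)).indicator (fun a : ℝ =>
          (Real.pi : ℂ) * Complex.Gamma ((s.re : ℂ) - 1) * (1 / (q : ℂ)) ^ ((s.re : ℂ) - 1) * (1 / (q : ℂ)) *
            ((a : ℂ) ^ ((s.re : ℂ) - 1) * cexp (-((p - normSq w / q : ℝ) * a)))) a).re := by
      funext a
      by_cases ha : 0 < a
      · rw [indicator_of_mem (show a ∈ Ioi (0 : ℝ) from ha), ← integral_fibre_zb f hf D hD hq hσ ha]
        have hint := integrable_fibre_zb f hf D hD hq hσ ha
        have h1 := Complex.reCLM.integral_comp_comm hint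
        simp only [Complex.reCLM_apply] at h1
        rw [Measure.volume_eq_prod, ← h1]
        exact integral_congr_ae (Filter.Eventually.of_forall fun zb => norm_indicator_eq f hf D hD s (a, zb))
      · rw [indicator_of_notMem (show a ∉ Ioi (0 : ℝ) from ha), Complex.zero_re]
        have h0 : (fun zb : ℂ × ℝ => ‖D.indicator (f s) (a, zb)‖) = fun _ => 0 := by
          funext zb
          rw [indicator_of_notMem, norm_zero]
          rw [hD]
          exact fun h => ha h.1
        rw [h0, integral_zero]
    rw [hre]
    have hint3 : Integrable ((Ioi (0 : ℝ)).indicator (fun a : ℝ =>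
        (Real.pi : ℂ) * Complex.Gamma ((s.re : ℂ) - 1) * (1 / (q : ℂ)) ^ ((s.re : ℂ) - 1) * (1 / (q : ℂ)) *
          ((a : ℂ) ^ ((s.re : ℂ) - 1) * cexp (-((p - normSq w / q : ℝ) * a))))) :=
      Integrable.of_integral_ne_zero (by
        rw [integral_indicator measurableSet_Ioi, integral_fibre_a hq hpq hσ]
        exact final_ne_zero hpq hσ)
    have h3 := hint3.re
    simpa using h3

include hf hD in
/-- THE VALUE in coordinates: `∫ 1_{x>0} e^{−tr(xy)} (det x)^{s−2} dx = Γ₂(s) · (pq − |w|²)^{−s}`. -/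
theorem integral_indicator_f (hq : 0 < q) (hpq : normSq w < p * q) {s : ℂ} (hs : 1 < s.re) :
    ∫ c : ℝ × ℂ × ℝ, D.indicator (f s) c = hermTwoGamma s * ((p * q - normSq w : ℝ) : ℂ) ^ (-s) := by
  rw [Measure.volume_eq_prod, integral_prod _ (integrable_indicator_f f hf D hD hq hpq hs)]
  have h1 : (fun a : ℝ => ∫ zb : ℂ × ℝ, D.indicator (f s) (a, zb)) =
      (Ioi (0 : ℝ)).indicator (fun a : ℝ =>
        (Real.pi : ℂ) * Complex.Gamma (s - 1) * (1 / (q : ℂ)) ^ (s - 1) * (1 / (q : ℂ)) *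
          ((a : ℂ) ^ (s - 1) * cexp (-((p - normSq w / q : ℝ) * a)))) := by
    funext a
    by_cases ha : 0 < a
    · rw [indicator_of_mem (show a ∈ Ioi (0 : ℝ) from ha)]
      exact integral_fibre_zb f hf D hD hq hs ha
    · rw [indicator_of_notMem (show a ∉ Ioi (0 : ℝ) from ha)]
      have h0 : (fun zb : ℂ × ℝ => D.indicator (f s) (a, zb)) = fun _ => 0 := by
        funext zb
        rw [indicator_of_notMem]
        rw [hD]
        exact fun h => ha h.1
      rw [h0, integral_zero]
  rw [h1, integral_indicator measurableSet_Ioi]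
  exact integral_fibre_a hq hpq hs

end Coordinates

/-! ## The heads: Siegel–Gindikin on `Herm₂(ℂ)⁺` -/

/-- SIEGEL–GINDIKIN INTEGRAL, chart form.  For `d = (p, w, q)` with `[[p, w],[w̄, q]] > 0` (i.e. `0 < p`, `|w|² < p·q`) and
`1 < re s`: `∫_{x > 0} e^{−tr(x·hermTwo d)} (det x)^{s−2} dx = Γ₂(s) · (p·q − |w|²)^{−s}`, the measure being Lebesgue measure
`da · dz · db` on the chart `x = hermTwo (a, z, b)` and the right-hand side the principal power of a POSITIVE REAL. -/
theorem integral_siegelGindikin_hermTwo (d : ℝ × ℂ × ℝ) (hd : 0 < d.1 ∧ normSq d.2.1 < d.1 * d.2.2)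
    {s : ℂ} (hs : 1 < s.re) :
    ∫ c in {c : ℝ × ℂ × ℝ | (hermTwo c).PosDef},
        cexp (-(hermTwo c * hermTwo d).trace) * (hermTwo c).det ^ (s - 2) =
      hermTwoGamma s * ((d.1 * d.2.2 - normSq d.2.1 : ℝ) : ℂ) ^ (-s) := by
  obtain ⟨p, w, q⟩ := d
  have hp : 0 < p := hd.1
  have hpq : normSq w < p * q := hd.2
  have hq : 0 < q := (mul_pos_iff_of_pos_left hp).mp (lt_of_le_of_lt (normSq_nonneg w) hpq)
  have hDm : MeasurableSet {c : ℝ × ℂ × ℝ | 0 < c.1 ∧ normSq c.2.1 < c.1 * c.2.2} := by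
    rw [← setOf_posDef_hermTwo]
    exact measurableSet_posDef_hermTwo
  rw [setOf_posDef_hermTwo, ← integral_indicator hDm]
  simp_rw [trace_hermTwo_mul_hermTwo, det_hermTwo]
  exact integral_indicator_f (p := p) (q := q) (w := w) (fun s c =>
      cexp (-((c.1 * p + c.2.2 * q + 2 * (c.2.1 * conj w).re : ℝ) : ℂ)) *
        ((c.1 * c.2.2 - normSq c.2.1 : ℝ) : ℂ) ^ (s - 2)) (fun _ _ => rfl)
    {c | 0 < c.1 ∧ normSq c.2.1 < c.1 * c.2.2} rfl hq hpq hs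

/-- ABSOLUTE CONVERGENCE, chart form: the Siegel–Gindikin integrand is integrable on the cone for `[[p, w],[w̄, q]] > 0`, `1 < re s`. -/
theorem integrableOn_siegelGindikin_hermTwo (d : ℝ × ℂ × ℝ) (hd : 0 < d.1 ∧ normSq d.2.1 < d.1 * d.2.2)
    {s : ℂ} (hs : 1 < s.re) :
    IntegrableOn (fun c : ℝ × ℂ × ℝ => cexp (-(hermTwo c * hermTwo d).trace) * (hermTwo c).det ^ (s - 2))
      {c : ℝ × ℂ × ℝ | (hermTwo c).PosDef} := by
  obtain ⟨p, w, q⟩ := d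
  have hp : 0 < p := hd.1
  have hpq : normSq w < p * q := hd.2
  have hq : 0 < q := (mul_pos_iff_of_pos_left hp).mp (lt_of_le_of_lt (normSq_nonneg w) hpq)
  have hDm : MeasurableSet {c : ℝ × ℂ × ℝ | 0 < c.1 ∧ normSq c.2.1 < c.1 * c.2.2} := by
    rw [← setOf_posDef_hermTwo]
    exact measurableSet_posDef_hermTwo
  rw [setOf_posDef_hermTwo, ← integrable_indicator_iff hDm]
  simp_rw [trace_hermTwo_mul_hermTwo, det_hermTwo]
  have h := integrable_indicator_f (p := p) (q := q) (w := w) (fun s c =>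
      cexp (-((c.1 * p + c.2.2 * q + 2 * (c.2.1 * conj w).re : ℝ) : ℂ)) *
        ((c.1 * c.2.2 - normSq c.2.1 : ℝ) : ℂ) ^ (s - 2)) (fun _ _ => rfl)
    {c | 0 < c.1 ∧ normSq c.2.1 < c.1 * c.2.2} rfl hq hpq hs
  rw [← Measure.volume_eq_prod] at h
  exact h

/-- For a positive definite `y`, `det y` is the positive real `y₀₀·y₁₁ − |y₀₁|²` (cast to `ℂ`); the rewrite consumers use to read
`y.det ^ (−s)` as the principal power `((r : ℝ) : ℂ) ^ (−s)` of a positive real. -/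
theorem det_eq_ofReal_of_posDef {y : Matrix (Fin 2) (Fin 2) ℂ} (hy : y.PosDef) :
    y.det = (((y 0 0).re * (y 1 1).re - normSq (y 0 1) : ℝ) : ℂ) ∧
      0 < (y 0 0).re * (y 1 1).re - normSq (y 0 1) := by
  have hy' : hermTwo ((y 0 0).re, y 0 1, (y 1 1).re) = y := hermTwo_eq_of_isHermitian hy.1
  have hd := (posDef_hermTwo_iff ((y 0 0).re, y 0 1, (y 1 1).re)).mp (hy'.symm ▸ hy)
  refine ⟨?_, by linarith [hd.2]⟩
  conv_lhs => rw [← hy']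
  rw [det_hermTwo]

/-- **SIEGEL–GINDIKIN INTEGRAL on `Herm₂(ℂ)⁺`** (organ Φ6a (b)).  For a positive definite Hermitian `2 × 2` complex matrix `y` and
`1 < re s`:  `∫_{x ∈ Herm₂(ℂ)⁺} e^{−tr(x y)} (det x)^{s−2} dx = Γ₂(s) · (det y)^{−s}`, where `dx` is Lebesgue measure on `Herm₂(ℂ) ≅
ℝ × ℂ × ℝ` (the chart `hermTwo`), `Γ₂(s) = π Γ(s) Γ(s−1)` (`hermTwoGamma`) and both powers are principal powers (`det x`, `det y` are
positive reals).  [Shimura1982, §1 (1.16), Case II, m = 2]; Faraut–Korányi Thm. VII.1.1. -/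
theorem integral_siegelGindikin {y : Matrix (Fin 2) (Fin 2) ℂ} (hy : y.PosDef) {s : ℂ} (hs : 1 < s.re) :
    ∫ c in {c : ℝ × ℂ × ℝ | (hermTwo c).PosDef},
        cexp (-(hermTwo c * y).trace) * (hermTwo c).det ^ (s - 2) = hermTwoGamma s * y.det ^ (-s) := by
  have hy' : hermTwo ((y 0 0).re, y 0 1, (y 1 1).re) = y := hermTwo_eq_of_isHermitian hy.1
  have hd := (posDef_hermTwo_iff ((y 0 0).re, y 0 1, (y 1 1).re)).mp (hy'.symm ▸ hy)
  rw [← hy', det_hermTwo]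
  exact integral_siegelGindikin_hermTwo _ hd hs

/-- **ABSOLUTE CONVERGENCE** (organ Φ6a (b), integrability clause): for `y > 0` and `1 < re s` the Siegel–Gindikin integrand
`x ↦ e^{−tr(x y)} (det x)^{s−2}` is integrable on the cone `Herm₂(ℂ)⁺` (Lebesgue measure of the chart `ℝ × ℂ × ℝ`). -/
theorem integrableOn_siegelGindikin {y : Matrix (Fin 2) (Fin 2) ℂ} (hy : y.PosDef) {s : ℂ} (hs : 1 < s.re) :
    IntegrableOn (fun c : ℝ × ℂ × ℝ => cexp (-(hermTwo c * y).trace) * (hermTwo c).det ^ (s - 2))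
      {c : ℝ × ℂ × ℝ | (hermTwo c).PosDef} := by
  have hy' : hermTwo ((y 0 0).re, y 0 1, (y 1 1).re) = y := hermTwo_eq_of_isHermitian hy.1
  have hd := (posDef_hermTwo_iff ((y 0 0).re, y 0 1, (y 1 1).re)).mp (hy'.symm ▸ hy)
  rw [← hy']
  exact integrableOn_siegelGindikin_hermTwo _ hd hs

/-- **THE GAMMA INTEGRAL OF THE CONE** (organ Φ6a (a)∕(b) at `y = 1`): `∫_{x > 0} e^{−tr x} (det x)^{s−2} dx = Γ₂(s) = π Γ(s) Γ(s−1)`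
for `1 < re s`. -/
theorem integral_siegelGindikin_one {s : ℂ} (hs : 1 < s.re) :
    ∫ c in {c : ℝ × ℂ × ℝ | (hermTwo c).PosDef},
        cexp (-(hermTwo c).trace) * (hermTwo c).det ^ (s - 2) = hermTwoGamma s := by
  have h := integral_siegelGindikin (y := 1) Matrix.PosDef.one hs
  simp only [Matrix.det_one, one_cpow, mul_one] at h
  exact h

/-- **HOLOMORPHY** (organ Φ6a (c)): for `y > 0` the Siegel–Gindikin integral is holomorphic in `s` on the open half-plane `1 < re s`
(it agrees there with the holomorphic closed form `Γ₂(s)·(det y)^{−s}`; no differentiation under the integral sign is needed). -/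
theorem differentiableOn_integral_siegelGindikin {y : Matrix (Fin 2) (Fin 2) ℂ} (hy : y.PosDef) :
    DifferentiableOn ℂ (fun s : ℂ => ∫ c in {c : ℝ × ℂ × ℝ | (hermTwo c).PosDef},
        cexp (-(hermTwo c * y).trace) * (hermTwo c).det ^ (s - 2)) {s : ℂ | 1 < s.re} := by
  have hdet : y.det ≠ 0 := by
    obtain ⟨h1, h2⟩ := det_eq_ofReal_of_posDef hy
    rw [h1]
    exact ofReal_ne_zero.mpr h2.ne'
  have hG : DifferentiableOn ℂ (fun s : ℂ => hermTwoGamma s * y.det ^ (-s)) {s : ℂ | 1 < s.re} := by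
    refine differentiableOn_hermTwoGamma.mul ?_
    intro s _
    exact (DifferentiableAt.const_cpow differentiableAt_id.neg (Or.inl hdet)).differentiableWithinAt
  exact hG.congr fun s hs => integral_siegelGindikin hy hs

/-- **HOLOMORPHY OF THE CLOSED FORM**: `s ↦ Γ₂(s)·(det y)^{−s}` is holomorphic on `1 < re s` (`y > 0`). -/
theorem differentiableOn_hermTwoGamma_mul_det_cpow {y : Matrix (Fin 2) (Fin 2) ℂ} (hy : y.PosDef) :
    DifferentiableOn ℂ (fun s : ℂ => hermTwoGamma s * y.det ^ (-s)) {s : ℂ | 1 < s.re} := by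
  have hdet : y.det ≠ 0 := by
    obtain ⟨h1, h2⟩ := det_eq_ofReal_of_posDef hy
    rw [h1]
    exact ofReal_ne_zero.mpr h2.ne'
  refine differentiableOn_hermTwoGamma.mul ?_
  intro s _
  exact (DifferentiableAt.const_cpow differentiableAt_id.neg (Or.inl hdet)).differentiableWithinAt

end Summit.HodgeConjecture.HodgeConjecture.Cruxes.HLiu418.K2LiuHermTwoGammaSiegelGindikin

end
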